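import Literature.Topology.FourManifolds.TracePolarModel
import Literature.Topology.FourManifolds.PairSaddleRigid
import HarnessLib

/-!
# Flow-polar charts of the boundary about the trace circles of the index-one saddles

Topic `Literature/Topology/FourManifolds` (support file for the Torelli half of Griffiths'
handlebody theorem, `stmt-SmoothPoincare4-15190`, after `TracePolarModel.lean`,
`PairSaddleRigid.lean`).  Everything here is **proved**; the definitions are explicit maps.

Griffiths (1964), §3, works in "meridian neighbourhoods" of the boundary of a handlebody;
Milnor (1965), proof of Thm. 3.13, identifies a neighbourhood of the belt sphere of a handle
with a piece of the level `c + ε²` by the trajectories of the gradient-like field.  For a pair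
of basin settings `P` on a compact `3`-manifold with boundary, saddle data `Q` and a saddle `s`
of index `1` (`(Q.DA s).k = 1`) we combine the two: the **flow-polar chart**

* `SaddleData.pol Q s w = bret_A (top_A (ψ_s (hypPoint ε w)))` — the boundary point whose
  `ξ_A`-trajectory crosses the exit sheet `{g = c + ε²}` of the box of `s` at the point with
  flow-polar coordinates `w ∈ ℝ² ∖ {0}` (`TracePolarModel.lean`); `SaddleData.polInv Q s` — its
  inverse, read off the exit point `Zpt y = levelProj θ_A (c + ε²) (push_A y)` of a boundary
  point `y`;
* `SaddleData.polarChart Q s hk : OpenPartialHomeomorph ∂W ℝ²` — source the boundary points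
  exiting through the exit set `Uexit s ε²`, target `{w ≠ 0, x₁(w)² < ε²}`; it is smooth with
  smooth inverse (`contMDiffOn_polarChart`, `contMDiffOn_polarChart_symm`); the sources of
  distinct saddles are disjoint (`disjoint_polSource`).

The unit circle of the chart is the trace circle of `s` (sequel, `TracePolarTrace.lean`).

## References

* H. B. Griffiths, *Automorphisms of a 3-dimensional handlebody*, Abh. Math. Sem. Univ. Hamburg
  26 (1964), §3. [GriffithsHB1964Handlebody]
* J. Milnor, *Lectures on the h-cobordism theorem* (1965), Def. 3.1 (2), Thm. 4.1, proof of
  Thm. 3.13 (PDF pp. 12, 18–22). [MilnorHCobordism1965]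
-/

open scoped Manifold ContDiff Topology
open Set Function Filter Metric

noncomputable section

namespace Literature.Topology.FourManifolds

open Cobordism FourManifolds.Flow TracePolar

universe u

variable {W : Type u} [TopologicalSpace W] [T2Space W] [SecondCountableTopology W]
  [CompactSpace W] [ChartedSpace (EuclideanHalfSpace (2 + 1)) W] [IsManifold (𝓡∂ (2 + 1)) ∞ W]

namespace BasinPair

namespace SaddleData

variable {g : W → ℝ} {ξA ξB : Π x : W, TangentSpace (𝓡∂ (2 + 1)) x} {P : BasinPair g ξA ξB}
  (Q : P.SaddleData)

/-- Local notation for the model plane and space. -/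
local notation "E2" => EuclideanSpace ℝ (Fin 2)
local notation "E3" => EuclideanSpace ℝ (Fin 3)

/-! ### The exit level and the exit point of a boundary point -/

/-- The exit level `c + ε²`. [folklore] -/
def exitLevel : ℝ := Q.c + Q.ε ^ 2

/-- `exitLevel_def`. [folklore] -/
theorem exitLevel_def : Q.exitLevel = Q.c + Q.ε ^ 2 := rfl

/-- The exit level lies in `(c, hi)`, `(g p₀, hi)`, `(lo, hi)`. [folklore] -/
theorem exitLevel_mem_Ioo_c : Q.exitLevel ∈ Ioo Q.c P.A.hi := Q.c_add_sq_mem_Ioo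

/-- `exitLevel_mem_Ioo_p₀`. [folklore] -/
theorem exitLevel_mem_Ioo_p₀ : Q.exitLevel ∈ Ioo (g P.A.p₀) P.A.hi := Q.Ioo_c_hi_subset Q.exitLevel_mem_Ioo_c

/-- `exitLevel_mem_Ioo_lo`. [folklore] -/
theorem exitLevel_mem_Ioo_lo : Q.exitLevel ∈ Ioo P.A.lo P.A.hi := P.A.Ioo_subset_Ioo_lo Q.exitLevel_mem_Ioo_p₀

/-- `exitLevel_lt_L`. [folklore] -/
theorem exitLevel_lt_L : Q.exitLevel < P.A.L := Q.c_add_sq_lt_L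

/-! ### The flow-polar point of the exit sheet and the flow-polar boundary point -/

/-- **The point of the exit sheet of the box of `s` with flow-polar coordinates `w`.** [cite: MilnorHCobordism1965, Def. 3.1 (2), proof of Thm. 3.13] -/
def polW (s : SaddlePt 2 g) (w : E2) : W :=
  ((Q.DA s).chart.extend (𝓡∂ (2 + 1))).symm ((Q.DA s).center + hypPoint Q.ε w)

/-- `polW_def`. [folklore] -/
theorem polW_def (s : SaddlePt 2 g) (w : E2) :
    Q.polW s w = ((Q.DA s).chart.extend (𝓡∂ (2 + 1))).symm ((Q.DA s).center + hypPoint Q.ε w) := rfl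

/-- **The target of the flow-polar chart**: `{w ≠ 0, x₁(w)² < ε²}`. [folklore] -/
def polTarget : Set E2 := {w | w ≠ 0 ∧ xco Q.ε w ^ 2 < Q.ε ^ 2}

/-- `mem_polTarget_iff`. [folklore] -/
theorem mem_polTarget_iff {w : E2} : w ∈ Q.polTarget ↔ w ≠ 0 ∧ xco Q.ε w ^ 2 < Q.ε ^ 2 := Iff.rfl

/-- The unit circle lies in the target. [folklore] -/
theorem mem_polTarget_of_norm_eq_one {w : E2} (hw : ‖w‖ = 1) : w ∈ Q.polTarget := by
  refine ⟨fun h => by rw [h, norm_zero] at hw; exact zero_ne_one hw, ?_⟩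
  rw [xco_of_norm_eq_one hw]; simpa using Q.sq_pos

/-- The target is open. [folklore] -/
theorem isOpen_polTarget : IsOpen Q.polTarget := by
  have h1 : ContinuousOn (fun w : E2 => xco Q.ε w ^ 2) {w | w ≠ 0} := fun w hw =>
    ((contDiffAt_xco hw).continuousAt.pow 2).continuousWithinAt
  have h2 := h1.isOpen_inter_preimage isOpen_ne (isOpen_Iio (a := Q.ε ^ 2))
  exact h2

variable {Q}

/-! ### Properties of the flow-polar point -/

section PolW

variable {s : SaddlePt 2 g}

/-- The flow-polar point lies in the `3ε`-chart ball, with coordinates `hypPoint ε w`. [folklore] -/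
theorem polW_mem_chartBall {w : E2} (hw : w ∈ Q.polTarget) :
    Q.polW s w ∈ (Q.DA s).chartBall (3 * Q.ε) ∧ (Q.DA s).coord (Q.polW s w) = hypPoint Q.ε w := by
  have hn : ‖hypPoint Q.ε w‖ < 3 * (Q.DA s).ε := by rw [Q.εA]; exact norm_hypPoint_lt Q.ε_pos hw.1 hw.2
  have h1 := (Q.DA s).symm_add_mem_chartBall le_rfl hn
  rw [Q.εA] at h1
  exact ⟨h1, (Q.DA s).coord_symm_add (by rw [Q.εA] at hn ⊢; exact hn.le)⟩

variable (hk : (Q.DA s).k = 1)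
include hk

/-- **The flow-polar point lies on the exit level.** [cite: MilnorHCobordism1965, Def. 3.1 (2)] -/
theorem apply_polW {w : E2} (hw : w ∈ Q.polTarget) : g (Q.polW s w) = Q.exitLevel := by
  obtain ⟨hb, hc⟩ := polW_mem_chartBall hw
  rw [Q.apply_eq_of_mem_chartBall hb, hc, hk, milnorQuadratic_hypPoint Q.ε_pos hw.1, exitLevel]

/-- The flow-polar point lies in the exit set of width `ε²`. [folklore] -/
theorem polW_mem_Uexit {w : E2} (hw : w ∈ Q.polTarget) : Q.polW s w ∈ Q.Uexit s (Q.ε ^ 2) := by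
  obtain ⟨hb, hc⟩ := polW_mem_chartBall hw
  exact ⟨hb, by rw [hc, hk, sqSumLT_hypPoint]; exact hw.2⟩

/-- The flow-polar point hits `L` and is non-critical, of level in `(g p₀, hi)`. [folklore] -/
theorem hits_L_polW {w : E2} (hw : w ∈ Q.polTarget) : Hits P.A.θ g P.A.L (Q.polW s w) :=
  Q.hits_L_of_exit (apply_polW hk hw)

/-- `apply_polW_mem_Ioo`. [folklore] -/
theorem apply_polW_mem_Ioo {w : E2} (hw : w ∈ Q.polTarget) : g (Q.polW s w) ∈ Ioo (g P.A.p₀) P.A.hi := by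
  rw [apply_polW hk hw]; exact Q.exitLevel_mem_Ioo_p₀

end PolW

/-- `polW` is smooth at the points of the target (indeed off the origin with `x₁² < ε²`). [folklore] -/
theorem contMDiffAt_polW {s : SaddlePt 2 g} {w : E2} (hw : w ∈ Q.polTarget) :
    ContMDiffAt 𝓘(ℝ, E2) (𝓡∂ (2 + 1)) ∞ (Q.polW s) w := by
  have hn : ‖hypPoint Q.ε w‖ < 3 * (Q.DA s).ε := by rw [Q.εA]; exact norm_hypPoint_lt Q.ε_pos hw.1 hw.2
  have h1 : ContMDiffAt 𝓘(ℝ, E2) 𝓘(ℝ, E3) ∞ (fun w => (Q.DA s).center + hypPoint Q.ε w) w :=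
    contMDiffAt_const.add (contDiffAt_hypPoint hw.1).contMDiffAt
  have hy : (Q.DA s).center + hypPoint Q.ε w ∈ ball ((Q.DA s).chart.extend (𝓡∂ (2 + 1)) s.1) (3 * (Q.DA s).ε) := by
    rw [mem_ball, dist_eq_norm, MilnorBox.center, add_sub_cancel_left]; exact hn
  exact ((Q.DA s).contMDiffAt_extend_symm hy).comp w h1

variable (Q)

/-- The push of a boundary point has level `L ∈ (c, hi)`. [folklore] -/
theorem apply_push_mem_Ioo_c (y : ((𝓡∂ (2 + 1)).boundary W)) : g (P.A.push (y : W)) ∈ Ioo Q.c P.A.hi := by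
  rw [P.A.apply_push_coe]; exact ⟨Q.c_lt_L, P.A.L_lt_hi⟩

/-- **The exit point** of the boundary point `y`: the point of its `ξ_A`-trajectory on the
level `c + ε²`. [cite: MilnorHCobordism1965, Thm. 4.1 (PDF p. 22)] -/
def Zpt (y : ((𝓡∂ (2 + 1)).boundary W)) : W := levelProj P.A.θ g Q.exitLevel (P.A.push (y : W))

/-- `Zpt_def`. [folklore] -/
theorem Zpt_def (y : ((𝓡∂ (2 + 1)).boundary W)) : Q.Zpt y = levelProj P.A.θ g Q.exitLevel (P.A.push (y : W)) := rfl

/-- The trajectory of the push meets the exit level. [folklore] -/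
theorem hits_exitLevel_push (y : ((𝓡∂ (2 + 1)).boundary W)) : Hits P.A.θ g Q.exitLevel (P.A.push (y : W)) :=
  Q.hits_A_of_mem_Ioo_c_hi (Q.apply_push_mem_Ioo_c y) Q.exitLevel_mem_Ioo_c

/-- The exit point lies on the exit level. [folklore] -/
theorem apply_Zpt (y : ((𝓡∂ (2 + 1)).boundary W)) : g (Q.Zpt y) = Q.exitLevel := P.A.apply_levelProj (Q.hits_exitLevel_push y)

/-- The exit point is non-critical. [folklore] -/
theorem not_isMCriticalPt_Zpt (y : ((𝓡∂ (2 + 1)).boundary W)) : ¬ IsMCriticalPt (𝓡∂ (2 + 1)) g (Q.Zpt y) :=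
  P.A.not_isMCriticalPt_levelProj (P.A.not_isMCriticalPt_of_eq_L (P.A.apply_push_coe y)) _

/-- **The top of the exit point is the push.** [folklore] -/
theorem top_Zpt (y : ((𝓡∂ (2 + 1)).boundary W)) : P.A.top (Q.Zpt y) = P.A.push (y : W) := P.A.top_levelProj (P.A.apply_push_coe y) _

/-- The exit point hits `L`. [folklore] -/
theorem hits_L_Zpt (y : ((𝓡∂ (2 + 1)).boundary W)) : Hits P.A.θ g P.A.L (Q.Zpt y) := Q.hits_L_of_exit (Q.apply_Zpt y)

/-- **The exit point is smooth in the boundary point.** [cite: MilnorHCobordism1965, proof of Thm. 5.4, Assertion 4 (PDF p. 29)] -/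
theorem contMDiff_Zpt : ContMDiff (𝓡 2) (𝓡∂ (2 + 1)) ∞ Q.Zpt := by
  intro y
  have h1 : ContMDiffAt (𝓡 2) (𝓡∂ (2 + 1)) ∞ (fun y : ((𝓡∂ (2 + 1)).boundary W) => P.A.push (y : W)) y :=
    P.A.contMDiff_push.contMDiffAt.comp y
      (BoundaryManifold.isSmoothEmbedding_subtype_val (n := 2) (W := W)).contMDiff.contMDiffAt
  have h2 : ContMDiffAt (𝓡∂ (2 + 1)) (𝓡∂ (2 + 1)) ∞ (levelProj P.A.θ g Q.exitLevel) (P.A.push (y : W)) :=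
    P.A.contMDiffAt_levelProj (P.A.apply_mem_slab (by rw [P.A.apply_push_coe]; exact P.A.L_lt_hi))
      (P.A.not_isMCriticalPt_of_eq_L (P.A.apply_push_coe y)) Q.exitLevel_mem_Ioo_lo (Q.hits_exitLevel_push y)
  exact h2.comp y h1

/-- `continuous_Zpt`. [folklore] -/
theorem continuous_Zpt : Continuous Q.Zpt := Q.contMDiff_Zpt.continuous

/-! ### The flow-polar boundary point and the flow-polar coordinates -/

/-- **The flow-polar coordinates of a boundary point** (junk off the source of the chart). [cite: GriffithsHB1964Handlebody, §3] -/
def polInv (s : SaddlePt 2 g) (y : ((𝓡∂ (2 + 1)).boundary W)) : E2 := polarOut Q.ε ((Q.DA s).coord (Q.Zpt y))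

/-- `polInv_def`. [folklore] -/
theorem polInv_def (s : SaddlePt 2 g) (y : ((𝓡∂ (2 + 1)).boundary W)) : Q.polInv s y = polarOut Q.ε ((Q.DA s).coord (Q.Zpt y)) := rfl

/-- **The source of the flow-polar chart**: boundary points exiting through the exit set of `s`
of width `ε²`. [folklore] -/
def polSource (s : SaddlePt 2 g) : Set ((𝓡∂ (2 + 1)).boundary W) := {y | Q.Zpt y ∈ Q.Uexit s (Q.ε ^ 2)}

/-- `mem_polSource_iff`. [folklore] -/
theorem mem_polSource_iff {s : SaddlePt 2 g} {y : ((𝓡∂ (2 + 1)).boundary W)} : y ∈ Q.polSource s ↔ Q.Zpt y ∈ Q.Uexit s (Q.ε ^ 2) := Iff.rfl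

/-- The source is open. [folklore] -/
theorem isOpen_polSource (s : SaddlePt 2 g) : IsOpen (Q.polSource s) :=
  (Q.isOpen_Uexit s _).preimage Q.continuous_Zpt

variable [Nonempty (BoundaryManifold.boundaryData 2 W).carrier]

/-- **The flow-polar boundary point**: the boundary point of the trajectory through the
flow-polar point of the exit sheet. [cite: GriffithsHB1964Handlebody, §3] [cite: MilnorHCobordism1965, proof of Thm. 3.13] -/
def pol (s : SaddlePt 2 g) (w : E2) : ((𝓡∂ (2 + 1)).boundary W) := P.A.bret (P.A.top (Q.polW s w))

/-- `pol_def`. [folklore] -/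
theorem pol_def (s : SaddlePt 2 g) (w : E2) : Q.pol s w = P.A.bret (P.A.top (Q.polW s w)) := rfl

/-- `bret (top (Zpt y)) = y`. [folklore] -/
theorem bret_top_Zpt (y : ((𝓡∂ (2 + 1)).boundary W)) : P.A.bret (P.A.top (Q.Zpt y)) = y := by rw [Q.top_Zpt, P.A.bret_push_coe]


variable {Q}

section PolBoundary

variable {s : SaddlePt 2 g} (hk : (Q.DA s).k = 1)
include hk

/-- **The exit point of the flow-polar boundary point is the flow-polar point.** [folklore] -/
theorem Zpt_pol {w : E2} (hw : w ∈ Q.polTarget) : Q.Zpt (Q.pol s w) = Q.polW s w := by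
  have hL : g (P.A.top (Q.polW s w)) = P.A.L := P.A.apply_top (hits_L_polW hk hw)
  rw [Zpt, pol, P.A.coe_bret (by rw [hL]; exact P.A.one_sub_a'_lt_L.le), P.A.push_ret_of_apply_eq_L hL,
    ← apply_polW hk hw]
  exact P.A.levelProj_top_self (hits_L_polW hk hw) (apply_polW_mem_Ioo hk hw)

/-- The flow-polar boundary point lies in the source. [folklore] -/
theorem pol_mem_polSource {w : E2} (hw : w ∈ Q.polTarget) : Q.pol s w ∈ Q.polSource s := by
  rw [mem_polSource_iff, Zpt_pol hk hw]; exact polW_mem_Uexit hk hw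

/-- **`polInv ∘ pol = id` on the target.** [folklore] -/
theorem polInv_pol {w : E2} (hw : w ∈ Q.polTarget) : Q.polInv s (Q.pol s w) = w := by
  rw [polInv, Zpt_pol hk hw, (polW_mem_chartBall hw).2, polarOut_hypPoint Q.ε_pos hw.1]

end PolBoundary

/-! ### Properties of the exit point of a point of the source -/

section Source

variable {s : SaddlePt 2 g} (hk : (Q.DA s).k = 1)
include hk

omit [Nonempty (BoundaryManifold.boundaryData 2 W).carrier] in
/-- The coordinates of the exit point of a source point lie on the sheet `Q₁ = ε²`. [folklore] -/
theorem milnorQuadratic_coord_Zpt {y : ((𝓡∂ (2 + 1)).boundary W)} (hy : y ∈ Q.polSource s) :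
    milnorQuadratic 1 ((Q.DA s).coord (Q.Zpt y)) = Q.ε ^ 2 := by
  have h := Q.apply_eq_of_mem_chartBall hy.1
  rw [Q.apply_Zpt, exitLevel, hk] at h
  linarith

/-- **`pol ∘ polInv = id` on the source.** [folklore] -/
theorem pol_polInv {y : ((𝓡∂ (2 + 1)).boundary W)} (hy : y ∈ Q.polSource s) : Q.pol s (Q.polInv s y) = y := by
  have hsh := milnorQuadratic_coord_Zpt hk hy
  have h1 : Q.polW s (Q.polInv s y) = Q.Zpt y := by
    rw [polW, polInv, hypPoint_polarOut Q.ε_pos hsh]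
    exact (Q.DA s).symm_add_coord_of_mem_chartBall hy.1
  rw [pol, h1, Q.bret_top_Zpt]

omit [Nonempty (BoundaryManifold.boundaryData 2 W).carrier] in
/-- `polInv` maps the source into the target. [folklore] -/
theorem polInv_mem_polTarget {y : ((𝓡∂ (2 + 1)).boundary W)} (hy : y ∈ Q.polSource s) : Q.polInv s y ∈ Q.polTarget := by
  have hsh := milnorQuadratic_coord_Zpt hk hy
  refine ⟨polarOut_ne_zero Q.ε_pos hsh, ?_⟩
  have h2 := hy.2
  rw [hk, sqSumLT_one] at h2
  rw [polInv, xco_polarOut Q.ε_pos hsh]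
  exact h2

end Source

/-! ### Smoothness -/

section Smooth

variable {s : SaddlePt 2 g} (hk : (Q.DA s).k = 1)
include hk

omit [Nonempty (BoundaryManifold.boundaryData 2 W).carrier] in
/-- **`polInv` is smooth at the points of the source.** [folklore] -/
theorem contMDiffAt_polInv {y : ((𝓡∂ (2 + 1)).boundary W)} (hy : y ∈ Q.polSource s) :
    ContMDiffAt (𝓡 2) 𝓘(ℝ, E2) ∞ (Q.polInv s) y := by
  have hsh := milnorQuadratic_coord_Zpt hk hy
  have h1 : ContMDiffAt (𝓡∂ (2 + 1)) 𝓘(ℝ, E3) ∞ (Q.DA s).coord (Q.Zpt y) :=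
    ((Q.DA s).chart.contMDiffAt_extend (Q.DA s).mem_maximalAtlas hy.1.1).sub contMDiffAt_const
  have h2 : ContMDiffAt (𝓡 2) 𝓘(ℝ, E3) ∞ (fun y => (Q.DA s).coord (Q.Zpt y)) y := h1.comp y (Q.contMDiff_Zpt y)
  exact (contDiffAt_polarOut_of_sheet Q.ε_pos hsh).contMDiffAt.comp y h2

/-- **`pol` is smooth at the points of the target.** [folklore] -/
theorem contMDiffAt_pol {w : E2} (hw : w ∈ Q.polTarget) : ContMDiffAt 𝓘(ℝ, E2) (𝓡 2) ∞ (Q.pol s) w := by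
  have hhit := hits_L_polW hk hw
  have hlt : g (Q.polW s w) < 1 := (apply_polW_mem_Ioo hk hw).2.trans P.A.hi_lt_one
  have h1 : ContMDiffAt 𝓘(ℝ, E2) (𝓡∂ (2 + 1)) ∞ (fun w => P.A.top (Q.polW s w)) w :=
    (P.A.contMDiffAt_top hlt hhit).comp w (contMDiffAt_polW hw)
  have h2 : ContMDiffAt (𝓡∂ (2 + 1)) (𝓡 2) ∞ P.A.bret (P.A.top (Q.polW s w)) :=
    P.A.contMDiffAt_bret (P.A.depth_lt_of_apply_eq_L (P.A.apply_top hhit))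
  exact h2.comp w h1

end Smooth

/-! ### The flow-polar chart -/

variable (Q) in
/-- **The flow-polar chart of `((𝓡∂ (2 + 1)).boundary W)` about the trace circle of the index-one saddle `s`.** [cite: GriffithsHB1964Handlebody, §3] [cite: MilnorHCobordism1965, Thm. 4.1, proof of Thm. 3.13] -/
def polarChart (s : SaddlePt 2 g) (hk : (Q.DA s).k = 1) : OpenPartialHomeomorph ((𝓡∂ (2 + 1)).boundary W) E2 where
  toFun := Q.polInv s
  invFun := Q.pol s
  source := Q.polSource s
  target := Q.polTarget
  map_source' _ hy := polInv_mem_polTarget hk hy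
  map_target' _ hw := pol_mem_polSource hk hw
  left_inv' _ hy := pol_polInv hk hy
  right_inv' _ hw := polInv_pol hk hw
  open_source := Q.isOpen_polSource s
  open_target := Q.isOpen_polTarget
  continuousOn_toFun := fun _ hy => (contMDiffAt_polInv hk hy).continuousAt.continuousWithinAt
  continuousOn_invFun := fun _ hw => (contMDiffAt_pol hk hw).continuousAt.continuousWithinAt

variable {s : SaddlePt 2 g} (hk : (Q.DA s).k = 1)

/-- `polarChart_apply`. [folklore] -/
@[simp] theorem polarChart_apply (y : ((𝓡∂ (2 + 1)).boundary W)) : Q.polarChart s hk y = Q.polInv s y := rfl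
/-- `polarChart_symm_apply`. [folklore] -/
@[simp] theorem polarChart_symm_apply (w : E2) : (Q.polarChart s hk).symm w = Q.pol s w := rfl
/-- `polarChart_source`. [folklore] -/
@[simp] theorem polarChart_source : (Q.polarChart s hk).source = Q.polSource s := rfl
/-- `polarChart_target`. [folklore] -/
@[simp] theorem polarChart_target : (Q.polarChart s hk).target = Q.polTarget := rfl

include hk in
/-- **The flow-polar chart is smooth on its source.** [folklore] -/
theorem contMDiffOn_polarChart : ContMDiffOn (𝓡 2) 𝓘(ℝ, E2) ∞ (Q.polarChart s hk) (Q.polarChart s hk).source :=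
  fun _ hy => (contMDiffAt_polInv hk hy).contMDiffWithinAt

include hk in
/-- **The inverse flow-polar chart is smooth on the target.** [folklore] -/
theorem contMDiffOn_polarChart_symm :
    ContMDiffOn 𝓘(ℝ, E2) (𝓡 2) ∞ (Q.polarChart s hk).symm (Q.polarChart s hk).target :=
  fun _ hw => (contMDiffAt_pol hk hw).contMDiffWithinAt

/-! ### Disjointness of the sources -/

omit [Nonempty (BoundaryManifold.boundaryData 2 W).carrier] in
/-- **The sources of the flow-polar charts of distinct saddles are disjoint** (the exit point of
a boundary point lies in at most one box). [folklore] -/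
theorem disjoint_polSource {s s' : SaddlePt 2 g} (h : s ≠ s') : Disjoint (Q.polSource s) (Q.polSource s') := by
  rw [Set.disjoint_left]
  intro y hy hy'
  exact Set.disjoint_left.1 (Q.disjA s s' h) hy.1.1 hy'.1.1

end SaddleData

end BasinPair

end Literature.Topology.FourManifolds
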